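import Literature.NumberTheory.PAdicHodge.TatePairingPointOfKTwoBasis
import Literature.NumberTheory.PAdicHodge.BmaxPlusPhiRoadPeriodHoms
import Literature.NumberTheory.PAdicHodge.BmaxPlusFormalLogLegendre
import HarnessLib

/-!
# Kato's reciprocity law modulo NOTHING BUT the cell data, with the φ-road's period maps (good supersingular `ℤ`-models)

Topic `Literature/NumberTheory/PAdicHodge`; THEOREMS ONLY (no definition, no named fact, no instance, no `sorry`). Brick B8b (i) of memo
`Summits/BirchSwinnertonDyer/BirchSwinnertonDyer/Cruxes/StarredOptimalManinUnitFiveSeven/Lines/kato-lever-K2-tower-instantiation.md` §6–§7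
(line `kato_lever`, crux K★ `stmt-BirchSwinnertonDyer-22226`): the socket's capstone in basis form
(`TatePairingPointOfKTwoBasis.exists_const_tatePairingPoint_eq_neg_trace_of_KTwoBasis`) INSTANTIATED with the φ-road's HONEST period maps
`Pω = f∘Λ`, `Pη = f∘φ∘Λ` on `T_pŴ(𝒪_ℂ)` (`BmaxPlusPhiRoadPeriodHoms.exists_phiRoad_periodHoms`: `Λ` the `A_max`-valued formal logarithm of the
torsion lifts, `f = bmaxPlusToBdR`, `φ` the Frobenius of `B⁺_max`) along an abstract `Γ_F`-equivariant matching `em : T_pW ≃ T_pŴ(𝒪_ℂ)` — for a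
`ℤ`-model `W` with good SUPERSINGULAR reduction at `p ≥ 5` (`p ∤ Δ_W`, `a_p ≡ 0`), over `F = K_v`.

What the φ-road buys over `TatePairingPointOfKTwoMatching` (K1's `(∫ω, ∫η)`): the hypothesis (K₂) is asked in the φ-road's `c_L`-FREE, `p`-power form
**`∀ i, ∃ M, IsTeichLog 2 (p^M·(Pη(bᵢ)·b_ω − Pω(bᵢ)·b_η))`** on a `ℤ_p`-basis — exactly what `isTeichLog_phiRoad_resolution` PROVES for the φ-road's
integrating pair `(b_ω, b_η) = (f Λ_P, f φΛ_P)` — because the φ-road's Legendre constant is `p`-ADICALLY RATIONAL: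

* §1 `exists_sq_mul_phiRoad_det_eq` — `p²·(Pω τ·Pη τ′ − Pη τ·Pω τ′) = λ·t_dR`, `λ ∈ ℤ_p` (B8a `exists_sq_mul_det_eq_zpToAinf_mul_tBmax` read through `f`);
  `exists_pow_mul_div_eq_coe` (`p^m·(a/λ) ∈ ℤ_p`); `exists_forall_isTeichLog_pow_mul_qpToBdR_mul` (a `ℚ_p`-rescaling of finitely many `p`-power
  memberships is again a `p`-power membership: `IsTeichLog.padicInt_smul`, `natCast_mul`).
* §2 ★★★ `exists_const_tatePairingPoint_eq_neg_trace_of_KTwo_phiRoad_of_matching` — at `F = K_v`: ONE pair `(c_L ≠ 0, c)` with the Legendre relation and,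
  for every cocycle `η`, every point `P` with `T`-adic Kummer cocycle `κ`, every integrating pair `(b_ω, b_η)` of `κ` for `(Pω∘em, Pη∘em)` with
  `θ(b_ω) = ι(c_P)`: **(K₂) in the φ-road's form ⟹ `⟨[η], P⟩ = −Tr_{F/ℚ_p}(c_P · exp*_d(η) · c)`**; inside, `ι(c_L) = λ/(p²e)` in `B_dR⁺` from §1 against
  the capstone's Legendre relation at a Weil-nondegenerate pair, so `ι(c_L⁻¹) ∈ ℚ_p` is absorbed into the `p`-power.

Every period-map hypothesis of the capstone (`hPωZ … hnot`) is DISCHARGED by the φ-road (`exists_phiRoad_periodHoms`, `…_supersingular`); what is left is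
the cell data (Weil tower, `ψ = log χ`, the de Rham binders `hinj / hde / d`) and the matching `em` (canonical one: `tateModuleEquiv ≫ tateGeomEquivTatePtSS`,
see `BmaxPlusPhiRoadReciprocityFormalPoint`). HONEST LIMITS: good supersingular `ℤ`-models only (the K★ cells are ramified); BSD / K★ / [REC] are NOT
proved by this file.

## References
* K. Kato, LNM 1553 (1993), Ch. II Thm. 1.4.1, Lemma 1.4.3. [Kato1993LNM1553]
* P. Colmez, Math. Ann. 292 (1992), §2 (Legendre relation). [Colmez1992PeriodesAbeliennes]
* J.-M. Fontaine, Astérisque 223 (1994), Exp. III Th. 5.3.7. [FontaineAsterisque223III]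
-/

noncomputable section

open Field Function ValuativeRel WittVector NumberField IsDedekindDomain
open scoped NumberField Topology

namespace Literature.NumberTheory.PAdicHodge

open Literature.NumberTheory.GaloisRepresentations
open Literature.NumberTheory.GaloisRepresentations.IsNonarchimedeanLocalField
open Literature.NumberTheory.GaloisRepresentations.LubinTate
open Literature.NumberTheory.GaloisCohomology
open Literature.NumberTheory.EllipticCurves
open Literature.NumberTheory.PAdicHodge.GaloisContinuity
open Literature.IUT.LogVolume
open Literature.RingTheory.FormalGroups Literature.AlgebraicGeometry.Resolution
open _root_.WeierstrassCurve

/-! ### §1 The φ-road's Legendre constant is `p`-adically rational; `ℚ_p`-rescaling of `p`-power memberships -/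

namespace AinfTop

section General

variable {F : Type} [Field F] [ValuativeRel F] [TopologicalSpace F] [IsNonarchimedeanLocalField F]
  [CharZero F] {p : ℕ} [Fact p.Prime] [Fact (¬ IsUnit (p : integerC F))]
  [IsAdicComplete (Ideal.span {(p : integerC F)}) (integerC F)]
  {hθ : Function.Surjective (fontaineTheta (integerC F) p)} (W : WeierstrassCurve ℤ)

set_option maxHeartbeats 1600000 in
/-- **`p²·(Pω τ·Pη τ′ − Pη τ·Pω τ′) = λ·t_dR` with `λ ∈ ℤ_p`** for the φ-road's maps `Pω = f∘Λ`, `Pη = f∘φ∘Λ` on `T_pŴ(𝒪_ℂ)` (`W ⊗ ℚ_p`, `W ⊗ 𝔽_p`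
elliptic, so `log_W` is of Honda type `p − a_pT + T²`): the `A_max`-Legendre relation `p²(Λ·φΛ′ − φΛ·Λ′) = ι(λ)·t`
(`exists_sq_mul_det_eq_zpToAinf_mul_tBmax`) read through the ring map `f = bmaxPlusToBdR` (`f ι(λ) = λ`, `f t = t_dR`).
[cite: Colmez1992PeriodesAbeliennes, §2] [cite: FontaineAsterisque223III, Exp. III Th. 5.3.7] -/
theorem exists_sq_mul_phiRoad_det_eq [(W.map (Int.castRingHom ℚ_[p])).IsElliptic] [(W.map (Int.castRingHom (ZMod p))).IsElliptic]
    {N : ℕ} (hN : 1 ≤ N) {Lh : TatePt F p W →+ BmaxPlus F p} {Pω Pη : TatePt F p W →+ BdRPlusTop F p}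
    (hLh : ∀ (τ : TatePt F p W) (z : bmaxZero F p),
        algebraMap (Ainf (p := p) F) (bmaxZero F p)
            ((of F p).symm (((torsionLiftHom W hθ τ).val : (nilTheta F p hθ).toIdeal) : AinfTop F p)) ^ N = (p : bmaxZero F p) * z →
        Lh τ = PadicLogSeries.logSum ((algebraMap (Ainf (p := p) F) (bmaxZero F p)).comp zpToAinf) (GaloisContinuity.formalLogNum W p) N
          (algebraMap (Ainf (p := p) F) (bmaxZero F p)
            ((of F p).symm (((torsionLiftHom W hθ τ).val : (nilTheta F p hθ).toIdeal) : AinfTop F p))) z)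
    (hPω : ∀ τ, Pω τ = BdRPlusTop.of F p (bmaxPlusToBdR F p (Lh τ)))
    (hPη : ∀ τ, Pη τ = BdRPlusTop.of F p (bmaxPlusToBdR F p (frobBmaxPlus F p (Lh τ)))) (τ τ' : TatePt F p W) :
    ∃ lam : ℤ_[p], (p : BdRPlusTop F p) ^ 2 * (Pω τ * Pη τ' - Pη τ * Pω τ') =
      BdRPlusTop.of F p (qpToBdR (lam : ℚ_[p])) * BdRPlusTop.of F p tBdR := by
  obtain ⟨z, hz⟩ := exists_witness_of_thetaPt_eq_zero W _ (thetaPt_torsionLiftHom W (hθ := hθ) τ) hN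
  obtain ⟨z', hz'⟩ := exists_witness_of_thetaPt_eq_zero W _ (thetaPt_torsionLiftHom W (hθ := hθ) τ') hN
  obtain ⟨e, he⟩ := exists_natCast_mul_eq_honda_formalLogNum W (p := p)
  have hu₀ : (((seq W τ 0 : (maxNilIdealC F).toIdeal) : CBall F) : CompletedAlgClosure F) = 0 := by rw [seq_zero]; rfl
  have hu'₀ : (((seq W τ' 0 : (maxNilIdealC F).toIdeal) : CBall F) : CompletedAlgClosure F) = 0 := by rw [seq_zero]; rfl
  obtain ⟨lam, hlam⟩ := exists_sq_mul_det_eq_zpToAinf_mul_tBmax W (hθ := hθ) _ e he (mulPC_seq W τ) (mulPC_seq W τ') hu₀ hu'₀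
    hN hN hz hz'
  have key : (p : BmaxPlus F p) ^ 2 * (Lh τ * frobBmaxPlus F p (Lh τ') - frobBmaxPlus F p (Lh τ) * Lh τ') =
      ainfToBmaxPlus F p (zpToAinf lam) * tBmax := by
    rw [hLh τ z hz, hLh τ' z' hz']
    exact hlam
  refine ⟨lam, ?_⟩
  have h := congrArg (fun x => BdRPlusTop.of F p (bmaxPlusToBdR F p x)) key
  simp only [map_mul, map_sub, map_pow, map_natCast, bmaxPlusToBdR_ainfToBmaxPlus_zpToAinf, bmaxPlusToBdR_tBmax] at h
  rw [hPω τ, hPω τ', hPη τ, hPη τ']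
  exact h

omit [Fact (¬ IsUnit (p : integerC F))] [IsAdicComplete (Ideal.span {(p : integerC F)}) (integerC F)] [CharZero F] [ValuativeRel F]
  [TopologicalSpace F] [IsNonarchimedeanLocalField F] [Field F] in
/-- `p^m · (a/λ) ∈ ℤ_p` for `λ ≠ 0` (`λ = u·p^m`, `u ∈ ℤ_pˣ`). [cite: FontaineAsterisque223III, Exp. II §1.5] -/
theorem exists_pow_mul_div_eq_coe (a lam : ℤ_[p]) (hlam : lam ≠ 0) :
    ∃ (m : ℕ) (b : ℤ_[p]), (p : ℚ_[p]) ^ m * ((a : ℚ_[p]) / (lam : ℚ_[p])) = (b : ℚ_[p]) := by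
  refine ⟨lam.valuation, a * ((PadicInt.unitCoeff hlam)⁻¹ : ℤ_[p]ˣ), ?_⟩
  have hs := PadicInt.unitCoeff_spec hlam
  have hu : ((PadicInt.unitCoeff hlam : ℤ_[p]) : ℚ_[p]) ≠ 0 := by
    rw [Ne, PadicInt.coe_eq_zero]; exact (PadicInt.unitCoeff hlam).ne_zero
  have hinv : ((((PadicInt.unitCoeff hlam)⁻¹ : ℤ_[p]ˣ) : ℤ_[p]) : ℚ_[p]) = ((PadicInt.unitCoeff hlam : ℤ_[p]) : ℚ_[p])⁻¹ := by
    refine eq_inv_of_mul_eq_one_left ?_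
    rw [← PadicInt.coe_mul, Units.inv_mul, PadicInt.coe_one]
  have hp0 : (p : ℚ_[p]) ^ lam.valuation ≠ 0 := pow_ne_zero _ (Nat.cast_ne_zero.2 (Fact.out : p.Prime).ne_zero)
  have hlamQ : (lam : ℚ_[p]) = ((PadicInt.unitCoeff hlam : ℤ_[p]) : ℚ_[p]) * (p : ℚ_[p]) ^ lam.valuation := by
    conv_lhs => rw [hs]
    rw [PadicInt.coe_mul, PadicInt.coe_pow, PadicInt.coe_natCast]
  rw [PadicInt.coe_mul, hinv, hlamQ]
  field_simp

/-- **A `ℚ_p`-rescaling of finitely many `p`-power memberships is a `p`-power membership**: if `p^m·q ∈ ℤ_p` and for each `i`,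
`IsTeichLog k (p^{Mᵢ}·Xᵢ)` for some `Mᵢ`, then for ONE `N`: `IsTeichLog k (p^N·(q·Xᵢ))` for all `i` (`N = m + max Mᵢ`; `X⁰_k + Fil^k` is a
`ℤ_p`-module: `IsTeichLog.padicInt_smul`, `natCast_mul`). [cite: FontaineOuyang2022, §6.1] -/
theorem exists_forall_isTeichLog_pow_mul_qpToBdR_mul {ι : Type*} [Fintype ι] {k m : ℕ} {q : ℚ_[p]} {b : ℤ_[p]}
    (hq : (p : ℚ_[p]) ^ m * q = b) {X : ι → BdRPlusTop F p}
    (hX : ∀ i, ∃ M : ℕ, IsTeichLog k ((BdRPlusTop.of F p).symm ((p : BdRPlusTop F p) ^ M * X i))) :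
    ∃ N : ℕ, ∀ i, IsTeichLog k ((BdRPlusTop.of F p).symm ((p : BdRPlusTop F p) ^ N * (BdRPlusTop.of F p (qpToBdR q) * X i))) := by
  choose M hM using hX
  refine ⟨m + Finset.univ.sup M, fun i => ?_⟩
  have hle : M i ≤ Finset.univ.sup M := Finset.le_sup (f := M) (Finset.mem_univ i)
  have hb : BdRPlusTop.of F p (qpToBdR (b : ℚ_[p])) = (p : BdRPlusTop F p) ^ m * BdRPlusTop.of F p (qpToBdR q) := by
    rw [← hq, map_mul, map_pow, map_natCast, map_mul, map_pow, map_natCast]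
  have hpow : (p : BdRPlusTop F p) ^ (m + Finset.univ.sup M) =
      (p : BdRPlusTop F p) ^ m * ((p : BdRPlusTop F p) ^ (Finset.univ.sup M - M i) * (p : BdRPlusTop F p) ^ M i) := by
    rw [← pow_add, Nat.sub_add_cancel hle, pow_add]
  have heq : (p : BdRPlusTop F p) ^ (m + Finset.univ.sup M) * (BdRPlusTop.of F p (qpToBdR q) * X i) =
      BdRPlusTop.of F p (qpToBdR (b : ℚ_[p])) *
        ((p : BdRPlusTop F p) ^ (Finset.univ.sup M - M i) * ((p : BdRPlusTop F p) ^ M i * X i)) := by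
    rw [hb, hpow]; ring
  have h := ((hM i).natCast_mul (p ^ (Finset.univ.sup M - M i))).padicInt_smul b
  rw [Nat.cast_pow] at h
  rw [heq, map_mul, map_mul, RingEquiv.symm_apply_apply, map_pow, map_natCast]
  exact h

end General

end AinfTop

/-! ### §2 The capstone with the φ-road's period maps along an abstract matching -/

section Completion

variable {K : Type} [Field K] [NumberField K] {p : ℕ} [hprime : Fact p.Prime] (v : HeightOneSpectrum (𝓞 K))
  [CharZero (v.adicCompletion K)] [LocallyCompactSpace (absoluteGaloisGroup (v.adicCompletion K))]
  [Fact (¬ IsUnit (p : integerC (v.adicCompletion K)))]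
  [IsAdicComplete (Ideal.span {(p : integerC (v.adicCompletion K))}) (integerC (v.adicCompletion K))]
  {K₀ : Type} [Field K₀] [CharZero K₀] (W : WeierstrassCurve K₀) [W.IsElliptic] [Algebra K₀ (v.adicCompletion K)]
  (e : (k : ℕ) → geomTorsion W ((p ^ k : ℕ) : ℤ) → geomTorsion W ((p ^ k : ℕ) : ℤ) → AlgebraicClosure K₀)
  (hμ : ∀ k S T, e k S T ^ (p ^ k) = 1) (hadd₁ : ∀ k S₁ S₂ T, e k (S₁ + S₂) T = e k S₁ T * e k S₂ T)
  (hadd₂ : ∀ k S T₁ T₂, e k S (T₁ + T₂) = e k S T₁ * e k S T₂)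
  (hgal : ∀ k (σ : absoluteGaloisGroup K₀) (S T : geomTorsion W ((p ^ k : ℕ) : ℤ)), σ • e k S T = e k (σ • S) (σ • T))
  (hcompat : ∀ k (S T : geomTorsion W ((p ^ (k + 1) : ℕ) : ℤ)),
    e k (torsionMulHom W (p ^ (k + 1)) (p ^ k) p (pow_succ p k).symm S)
      (torsionMulHom W (p ^ (k + 1)) (p ^ k) p (pow_succ p k).symm T) = e (k + 1) S T ^ p)

set_option maxHeartbeats 1600000 in
include hgal in
/-- ★★★ **Kato's reciprocity law at a completion with the φ-road's period maps, modulo (K₂) in the φ-road's `c_L`-free form.**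
`F = K_v`; `Wℤ/ℤ` with good supersingular reduction at `p ≥ 5` (`p ∤ Δ`, `a_p ≡ 0`; `Wℤ ⊗ ℚ_p`, `Wℤ ⊗ 𝔽_p` elliptic); `W/K₀` (`K₀ ⊆ F`) with an
equivariant matching `em : T_pW ≃ T_pŴℤ(𝒪_ℂ)`; `(Λ, Pω₀, Pη₀)` the φ-road's maps on `T_pŴℤ(𝒪_ℂ)` with the nine properties of
`AinfTop.exists_phiRoad_periodHoms` (hypotheses `hLh … hfil₀`, obtained from that theorem). Then with `Pω := Pω₀∘em`, `Pη := Pη₀∘em` there is ONE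
pair `(c_L ≠ 0, c)` with the Legendre relation such that for every `η`, every `P` with `T`-adic Kummer cocycle `κ`, every integrating pair
`(b_ω, b_η)` with `θ(b_ω) = ι(c_P)` and every `ℤ_p`-basis `b` of `T_pW`:
**`(∀ i, ∃ M, IsTeichLog 2 (p^M·(Pη(bᵢ)·b_ω − Pω(bᵢ)·b_η))) ⟹ ⟨[η], P⟩ = −Tr_{F/ℚ_p}(c_P · exp*_d(η) · c)`.**
The period-map hypotheses of the capstone are discharged by the φ-road (`ℤ_p`-linearity, equivariance, `Pω ⊆ Fil¹`, `Pω ≠ 0`, `Pη ⊄ Fil¹` —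
`exists_phiRoad_periodHoms_supersingular`), and `ι(c_L⁻¹) ∈ ℚ_p` (§1) turns the φ-road's (K₂) into the capstone's rescaled basis form.
[cite: Kato1993LNM1553, Ch. II Thm. 1.4.1 (3)–(4) and Lemma 1.4.3] [cite: Colmez1992PeriodesAbeliennes, §2]
[cite: FontaineAsterisque223III, Exp. III Th. 5.3.7] -/
theorem exists_const_tatePairingPoint_eq_neg_trace_of_KTwo_phiRoad_of_matching
    (hpv : valuation (v.adicCompletion K) (p : v.adicCompletion K) < 1)
    (Wℤ : WeierstrassCurve ℤ) (hp5 : 5 ≤ p) (hΔ : ¬ (p : ℤ) ∣ Wℤ.Δ) (hA : (Wℤ.map (Int.castRingHom (ZMod p))).hasseCoeff p = 0)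
    [(Wℤ.map (Int.castRingHom ℚ_[p])).IsElliptic] [(Wℤ.map (Int.castRingHom (ZMod p))).IsElliptic]
    (em : W.tateModule p ≃ₗ[ℤ_[p]] AinfTop.TatePt (v.adicCompletion K) p Wℤ)
    (hem : ∀ (σ : absoluteGaloisGroup (v.adicCompletion K)) (a : W.tateModule p), em (absGaloisRestrict K₀ (v.adicCompletion K) σ • a) = σ • em a)
    {N : ℕ} (hN : 1 ≤ N) {Lh : AinfTop.TatePt (v.adicCompletion K) p Wℤ →+ BmaxPlus (v.adicCompletion K) p}
    {Pω₀ Pη₀ : AinfTop.TatePt (v.adicCompletion K) p Wℤ →+ BdRPlusTop (v.adicCompletion K) p}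
    (hLh : ∀ (τ : AinfTop.TatePt (v.adicCompletion K) p Wℤ) (z : bmaxZero (v.adicCompletion K) p),
        algebraMap (Ainf (p := p) (v.adicCompletion K)) (bmaxZero (v.adicCompletion K) p)
            ((AinfTop.of (v.adicCompletion K) p).symm (((AinfTop.torsionLiftHom Wℤ (surjective_fontaineTheta_integerC hpv) τ).val :
              (AinfTop.nilTheta (v.adicCompletion K) p (surjective_fontaineTheta_integerC hpv)).toIdeal) : AinfTop (v.adicCompletion K) p)) ^ N =
          (p : bmaxZero (v.adicCompletion K) p) * z →
        Lh τ = PadicLogSeries.logSum ((algebraMap (Ainf (p := p) (v.adicCompletion K)) (bmaxZero (v.adicCompletion K) p)).comp zpToAinf)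
          (GaloisContinuity.formalLogNum Wℤ p) N
          (algebraMap (Ainf (p := p) (v.adicCompletion K)) (bmaxZero (v.adicCompletion K) p)
            ((AinfTop.of (v.adicCompletion K) p).symm (((AinfTop.torsionLiftHom Wℤ (surjective_fontaineTheta_integerC hpv) τ).val :
              (AinfTop.nilTheta (v.adicCompletion K) p (surjective_fontaineTheta_integerC hpv)).toIdeal) : AinfTop (v.adicCompletion K) p))) z)
    (hPω₀ : ∀ τ, Pω₀ τ = BdRPlusTop.of (v.adicCompletion K) p (bmaxPlusToBdR (v.adicCompletion K) p (Lh τ)))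
    (hPη₀ : ∀ τ, Pη₀ τ = BdRPlusTop.of (v.adicCompletion K) p (bmaxPlusToBdR (v.adicCompletion K) p (frobBmaxPlus (v.adicCompletion K) p (Lh τ))))
    (hPωω : ∀ τ, Pω₀ τ = (p : BdRPlusTop (v.adicCompletion K) p) ^ N * AinfTop.omegaPeriodHom Wℤ (surjective_fontaineTheta_integerC hpv) τ)
    (hPω₀Z : ∀ (c : ℤ_[p]) (τ : AinfTop.TatePt (v.adicCompletion K) p Wℤ),
      Pω₀ (c • τ) = BdRPlusTop.of (v.adicCompletion K) p (qpToBdR (c : ℚ_[p])) * Pω₀ τ)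
    (hPη₀Z : ∀ (c : ℤ_[p]) (τ : AinfTop.TatePt (v.adicCompletion K) p Wℤ),
      Pη₀ (c • τ) = BdRPlusTop.of (v.adicCompletion K) p (qpToBdR (c : ℚ_[p])) * Pη₀ τ)
    (hPω₀g : ∀ (σ : absoluteGaloisGroup (v.adicCompletion K)) (τ : AinfTop.TatePt (v.adicCompletion K) p Wℤ),
      BdRPlusTop.gal (v.adicCompletion K) p σ (Pω₀ τ) = Pω₀ (σ • τ))
    (hPη₀g : ∀ (σ : absoluteGaloisGroup (v.adicCompletion K)) (τ : AinfTop.TatePt (v.adicCompletion K) p Wℤ),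
      BdRPlusTop.gal (v.adicCompletion K) p σ (Pη₀ τ) = Pη₀ (σ • τ))
    (hfil₀ : ∀ τ, Pω₀ τ ∈ (BdRPlusTop.filOne (v.adicCompletion K) p).toIdeal)
    (ψ : C(absoluteGaloisGroup (v.adicCompletion K), ℤ_[p])) (hψ : ∀ σ τ, ψ (σ * τ) = ψ σ + ψ τ)
    (hψlog : ∀ τ, (ψ τ : ℚ_[p]) = logCyclotomic (F := v.adicCompletion K) p τ)
    (heL : ∀ (c : ℤ_[p]) (S U : W.tateModule p), (weilContPairingPadic W (v.adicCompletion K) p e hμ hadd₁ hadd₂ hgal hcompat).toLin (c • S) U =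
      twistHom (v.adicCompletion K) p ((weilContPairingPadic W (v.adicCompletion K) p e hμ hadd₁ hadd₂ hgal hcompat).toLin S U) c)
    (healt : ∀ S : W.tateModule p, (weilContPairingPadic W (v.adicCompletion K) p e hμ hadd₁ hadd₂ hgal hcompat).toLin S S = 0)
    (henondeg : ∀ S : W.tateModule p,
      (∀ U, (weilContPairingPadic W (v.adicCompletion K) p e hμ hadd₁ hadd₂ hgal hcompat).toLin S U = 0) → S = 0)
    (hinj : letI := LocalField.padicAlgebra (v.adicCompletion K) p hpv
      (bdRPeriodRingData (F := v.adicCompletion K) (p := p) hpv).CupLogInjective (logCyclotomic p) (restrictedRationalTateRep W (v.adicCompletion K) p))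
    (hde : letI := LocalField.padicAlgebra (v.adicCompletion K) p hpv
      ∀ η : contOneCocycles (restrictedTateRep W (v.adicCompletion K) p).toTopRep,
        (bdRPeriodRingData (F := v.adicCompletion K) (p := p) hpv).HasDualExp (logCyclotomic p) (restrictedRationalTateRep W (v.adicCompletion K) p)
          fun σ => TateModule.toRational p (η.1 σ))
    (d : letI := LocalField.padicAlgebra (v.adicCompletion K) p hpv
      (bdRPeriodRingData (F := v.adicCompletion K) (p := p) hpv).FilZeroLine (restrictedRationalTateRep W (v.adicCompletion K) p)) :
    letI := LocalField.padicAlgebra (v.adicCompletion K) p hpv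
    let hF := surjective_fontaineTheta_integerC hpv
    let Pω : W.tateModule p →+ BdRPlusTop (v.adicCompletion K) p := Pω₀.comp em.toAddMonoidHom
    let Pη : W.tateModule p →+ BdRPlusTop (v.adicCompletion K) p := Pη₀.comp em.toAddMonoidHom
    ∃ (cL c : v.adicCompletion K), cL ≠ 0 ∧
      (∀ S U : W.tateModule p, Pω S * Pη U - Pη S * Pω U = BdRPlusTop.of (v.adicCompletion K) p (embBdRHom hpv hF cL) *
        BdRPlusTop.periodLine (v.adicCompletion K) p ((weilContPairingPadic W (v.adicCompletion K) p e hμ hadd₁ hadd₂ hgal hcompat).toLin S U)) ∧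
      ∀ (η κ : contOneCocycles (restrictedTateRep W (v.adicCompletion K) p).toTopRep) (P : (W.baseChange (v.adicCompletion K)).toAffine.Point),
        (∀ j, (cohomologyMap (tateProjMor W (v.adicCompletion K) p j) 1).hom (oneCocycleClass _ κ) = kummerLevelClass W (v.adicCompletion K) p j P) →
        ∀ (bω bη : BdRPlusTop (v.adicCompletion K) p) (cP : v.adicCompletion K),
          (∀ τ, Pω (κ.1 τ) = BdRPlusTop.gal (v.adicCompletion K) p τ bω - bω) → (∀ τ, Pη (κ.1 τ) = BdRPlusTop.gal (v.adicCompletion K) p τ bη - bη) →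
          thetaBdR ((BdRPlusTop.of (v.adicCompletion K) p).symm bω) = algebraMap (v.adicCompletion K) (CompletedAlgClosure (v.adicCompletion K)) cP →
          ∀ {ι : Type} [Fintype ι] (b : Module.Basis ι ℤ_[p] (W.tateModule p)),
            (∀ i, ∃ M : ℕ, IsTeichLog 2 ((BdRPlusTop.of (v.adicCompletion K) p).symm ((p : BdRPlusTop (v.adicCompletion K) p) ^ M *
              (Pη (b i) * bω - Pω (b i) * bη)))) →
            ((tatePairingPoint W (v.adicCompletion K) p e hμ hadd₁ hadd₂ hgal hcompat (oneCocycleClass _ η) P : ℤ_[p]) : ℚ_[p]) =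
              -Algebra.trace ℚ_[p] (v.adicCompletion K) (cP * (expStarCoord W hpv d η * c)) := by
  intro hF Pω Pη
  have hPωapp : ∀ a, Pω a = Pω₀ (em a) := fun _ => rfl
  have hPηapp : ∀ a, Pη a = Pη₀ (em a) := fun _ => rfl
  -- the capstone's period-map hypotheses, discharged by the φ-road
  have hPωZ : ∀ (c : ℤ_[p]) (a : W.tateModule p), Pω (c • a) = BdRPlusTop.of (v.adicCompletion K) p (qpToBdR (c : ℚ_[p])) * Pω a :=
    fun c a => by rw [hPωapp, hPωapp, map_smul, hPω₀Z]
  have hPηZ : ∀ (c : ℤ_[p]) (a : W.tateModule p), Pη (c • a) = BdRPlusTop.of (v.adicCompletion K) p (qpToBdR (c : ℚ_[p])) * Pη a :=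
    fun c a => by rw [hPηapp, hPηapp, map_smul, hPη₀Z]
  have hPω : ∀ (σ : absoluteGaloisGroup (v.adicCompletion K)) (a : W.tateModule p),
      BdRPlusTop.gal (v.adicCompletion K) p σ (Pω a) = Pω (restrictedTateRep W (v.adicCompletion K) p σ a) := fun σ a => by
    rw [hPωapp, hPωapp, hPω₀g, restrictedTateRep_apply_apply, hem]
  have hPη : ∀ (σ : absoluteGaloisGroup (v.adicCompletion K)) (a : W.tateModule p),
      BdRPlusTop.gal (v.adicCompletion K) p σ (Pη a) = Pη (restrictedTateRep W (v.adicCompletion K) p σ a) := fun σ a => by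
    rw [hPηapp, hPηapp, hPη₀g, restrictedTateRep_apply_apply, hem]
  have hfil : ∀ a, Pω a ∈ (BdRPlusTop.filOne (v.adicCompletion K) p).toIdeal := fun a => by rw [hPωapp]; exact hfil₀ _
  obtain ⟨⟨τ₁, hτ₁⟩, ⟨τ₂, hτ₂⟩⟩ := AinfTop.exists_phiRoad_periodHoms_supersingular (F := v.adicCompletion K) Wℤ
    (hθ := surjective_fontaineTheta_integerC hpv) hp5 hΔ hA hN hLh hPωω hPη₀
  have hne : ∃ a, Pω a ≠ 0 := ⟨em.symm τ₁, by rwa [hPωapp, LinearEquiv.apply_symm_apply]⟩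
  have hnot : ∃ a, Pη a ∉ (BdRPlusTop.filOne (v.adicCompletion K) p).toIdeal :=
    ⟨em.symm τ₂, by rwa [hPηapp, LinearEquiv.apply_symm_apply]⟩
  obtain ⟨cL, c, hcL, hLeg, hmain⟩ := exists_const_tatePairingPoint_eq_neg_trace_of_KTwoBasis v W e hμ hadd₁ hadd₂ hgal hcompat hpv hF
    ψ hψ hψlog hPωZ hPηZ hPω hPη hfil hne hnot heL healt henondeg hinj hde d
  refine ⟨cL, c, hcL, hLeg, fun η κ P hκ bω bη cP hbω hbη hθb ι _ b hK => ?_⟩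
  -- `ι(c_L) ∈ ℚ_p`: compare the capstone's Legendre relation with the φ-road's at a Weil-nondegenerate pair `(a, U)`
  obtain ⟨a, ha⟩ := hne
  have ha0 : a ≠ 0 := fun h => ha (by rw [h, map_zero])
  obtain ⟨U, hU⟩ : ∃ U, (weilContPairingPadic W (v.adicCompletion K) p e hμ hadd₁ hadd₂ hgal hcompat).toLin a U ≠ 0 := by
    by_contra h
    push Not at h
    exact ha0 (henondeg a h)
  have he0 : ((epsLineEquiv (v.adicCompletion K) p).symm
      ((weilContPairingPadic W (v.adicCompletion K) p e hμ hadd₁ hadd₂ hgal hcompat).toLin a U) : ℤ_[p]) ≠ 0 := fun h =>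
    hU ((epsLineEquiv (v.adicCompletion K) p).symm.injective (by rw [h, map_zero]))
  obtain ⟨lam, hlam⟩ := AinfTop.exists_sq_mul_phiRoad_det_eq (F := v.adicCompletion K) Wℤ (hθ := surjective_fontaineTheta_integerC hpv)
    hN hLh hPω₀ hPη₀ (em a) (em U)
  have hLaU := hLeg a U
  rw [hPωapp, hPωapp, hPηapp, hPηapp, BdRPlusTop.periodLine_apply] at hLaU
  obtain ⟨e₀, he₀⟩ : ∃ e₀ : ℤ_[p], ((epsLineEquiv (v.adicCompletion K) p).symm
      ((weilContPairingPadic W (v.adicCompletion K) p e hμ hadd₁ hadd₂ hgal hcompat).toLin a U) : ℤ_[p]) = e₀ := ⟨_, rfl⟩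
  rw [he₀] at hLaU he0
  haveI := isDomain_bDeRhamPlus hF
  have hkey : embBdRHom hpv hF cL * qpToBdR ((((p : ℤ_[p]) ^ 2 * e₀ : ℤ_[p]) : ℚ_[p])) = qpToBdR (lam : ℚ_[p]) := by
    apply mul_right_cancel₀ (tBdR_ne_zero hF)
    apply (BdRPlusTop.of (v.adicCompletion K) p).injective
    simp only [map_mul]
    rw [← hlam, hLaU]
    simp only [map_mul, map_pow, map_natCast, PadicInt.coe_mul, PadicInt.coe_pow, PadicInt.coe_natCast]
    ring
  have hlam0 : lam ≠ 0 := by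
    rintro rfl
    rw [PadicInt.coe_zero, map_zero, mul_eq_zero, map_eq_zero_iff _ (embBdRHom_injective hpv hF),
      map_eq_zero_iff _ (qpToBdR (F := v.adicCompletion K) (p := p)).injective, PadicInt.coe_eq_zero, mul_eq_zero] at hkey
    rcases hkey with h | h | h
    · exact hcL h
    · exact (Fact.out : p.Prime).ne_zero (by exact_mod_cast (pow_eq_zero_iff two_ne_zero).1 h)
    · exact he0 h
  -- `ι(c_L⁻¹) = q ∈ ℚ_p` with `p^{m₀} q ∈ ℤ_p`
  obtain ⟨q, hqdef⟩ : ∃ q : ℚ_[p], q = (((p : ℤ_[p]) ^ 2 * e₀ : ℤ_[p]) : ℚ_[p]) / (lam : ℚ_[p]) := ⟨_, rfl⟩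
  have hr : embBdRHom hpv hF cL⁻¹ = qpToBdR q := by
    have h1 : embBdRHom hpv hF cL⁻¹ * embBdRHom hpv hF cL = 1 := by rw [← map_mul, inv_mul_cancel₀ hcL, map_one]
    have hlamQ : (lam : ℚ_[p]) ≠ 0 := by rw [Ne, PadicInt.coe_eq_zero]; exact hlam0
    calc embBdRHom hpv hF cL⁻¹
        = embBdRHom hpv hF cL⁻¹ * (embBdRHom hpv hF cL * qpToBdR ((((p : ℤ_[p]) ^ 2 * e₀ : ℤ_[p]) : ℚ_[p]))) *
            qpToBdR ((lam : ℚ_[p])⁻¹) := by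
          rw [hkey, mul_assoc, ← map_mul, mul_inv_cancel₀ hlamQ, map_one, mul_one]
      _ = qpToBdR q := by rw [← mul_assoc, h1, one_mul, ← map_mul, hqdef, div_eq_mul_inv]
  obtain ⟨m₀, b₀, hb₀⟩ := AinfTop.exists_pow_mul_div_eq_coe (p := p) ((p : ℤ_[p]) ^ 2 * e₀) lam hlam0
  rw [← hqdef] at hb₀
  -- the φ-road's (K₂) ⟹ the capstone's rescaled basis form, at ONE exponent
  obtain ⟨N', hN'⟩ := AinfTop.exists_forall_isTeichLog_pow_mul_qpToBdR_mul (F := v.adicCompletion K) (k := 2) hb₀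
    (X := fun i => Pη (b i) * bω - Pω (b i) * bη) hK
  refine hmain η κ P hκ bω bη cP hbω hbη hθb N' b fun i => ?_
  have h := hN' i
  have heq : BdRPlusTop.of (v.adicCompletion K) p (embBdRHom hpv hF cL⁻¹) * Pη (b i) * bω -
      Pω (b i) * (BdRPlusTop.of (v.adicCompletion K) p (embBdRHom hpv hF cL⁻¹) * bη) =
      BdRPlusTop.of (v.adicCompletion K) p (qpToBdR q) * (Pη (b i) * bω - Pω (b i) * bη) := by rw [hr]; ring
  rw [heq]
  exact h

end Completion

end Literature.NumberTheory.PAdicHodge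

end
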